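import Literature.Analysis.Calculus.CoordinateJetsDirectional
import HarnessLib

/-!
# Differentiating the jet equation once along a basis direction
(helper file for stub O3 `stub_regularity`, layer Rdiff `helper_differentiateEquation`, line
`margerin-cone-hamilton-rails`, crux `EntropyRung.ChangGurskyYang`, item stmt-SmoothPoincare4-10834)

In the elliptic-regularity induction for the Gursky–Viaclovsky path equation, written in a chart
as a jet equation `H(c(y), J²v(y)) = 0` with a `C¹` coefficient map `c` and a `C³` solution `v`,
the directional derivative `∂_{e_k} v` solves the linearised equation
`DH(c(y), J²v(y)) · (Dc(y) e_k, J²(∂_{e_k} v)(y)) = 0` (Gilbarg–Trudinger 2001, §17.4 /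
Lemma 17.16).  This is the specialisation `m = 2` of
`Literature.Analysis.Calculus.fderiv_apply_eq_zero_of_comp_prod_cjetOf`
(`CoordinateJetsDirectional.lean`: the function `z ↦ H(c(z), J²v(z))` vanishes on the open set,
so its derivative along `e_k` vanishes; the chain rule and the fact that taking coordinate jets
commutes with directional differentiation, `ins k (J³v(y)) = J²(∂_{e_k} v)(y)`, identify that
derivative).

## References

* D. Gilbarg, N. S. Trudinger, *Elliptic Partial Differential Equations of Second Order*,
  Classics in Mathematics, Springer 2001, §17.4 and Lemma 17.16. [GilbargTrudinger2001]
-/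

noncomputable section

-- every `Summit.SmoothPoincare4.SmoothPoincare4.…` name repeats the summit = sub-problem segment (D-0017 layout)
set_option linter.dupNamespace false

namespace Summit.SmoothPoincare4.SmoothPoincare4.Theorems.MargerinRails

/-- **Rdiff: differentiating the equation once along a basis direction.** If
`H(c(y), J²v(y)) = 0` on an open set `U`, with `H` of class `C¹`, `c` of class `C¹` and `v` of
class `C³` on `U`, then for every basis direction `e_k` and every `y ∈ U`,
`DH(c(y), J²v(y)) · (Dc(y) e_k, J²(∂_{e_k} v)(y)) = 0` (Gilbarg–Trudinger 2001, §17.4; the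
tree's `Literature.Analysis.Calculus.fderiv_apply_eq_zero_of_comp_prod_cjetOf` with `m = 2`).
[cite: GilbargTrudinger2001, §17.4, Lemma 17.16] -/
theorem helper_differentiateEquation :
    ∀ {ι : Type} [Fintype ι] [DecidableEq ι] {E : Type} [NormedAddCommGroup E] [InnerProductSpace ℝ E]
      [FiniteDimensional ℝ E] {P : Type} [NormedAddCommGroup P] [NormedSpace ℝ P]
      (bE : OrthonormalBasis ι ℝ E) (H : P × Literature.Analysis.Calculus.CJet ι 2 → ℝ),
      ContDiff ℝ 1 H →
      ∀ (c : E → P) (v : E → ℝ) (U : Set E), IsOpen U → ContDiffOn ℝ 1 c U → ContDiffOn ℝ 3 v U →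
      (∀ y ∈ U, H (c y, Literature.Analysis.Calculus.cjetOf bE 2 v y) = 0) →
      ∀ (k : ι), ∀ y ∈ U,
        fderiv ℝ H (c y, Literature.Analysis.Calculus.cjetOf bE 2 v y)
          (fderiv ℝ c y (bE k),
            Literature.Analysis.Calculus.cjetOf bE 2 (fun z => fderiv ℝ v z (bE k)) y) = 0 := by
  intro ι _ _ E _ _ _ P _ _ bE H hH c v U hU hc hv h0 k y hy
  have hv' : ContDiffOn ℝ ((2 + 1 : ℕ) : WithTop ℕ∞) v U := hv
  exact Literature.Analysis.Calculus.fderiv_apply_eq_zero_of_comp_prod_cjetOf bE hU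
    (fun z _ => (hH.differentiable one_ne_zero).differentiableAt)
    (hc.differentiableOn one_ne_zero) hv' h0 k y hy

end Summit.SmoothPoincare4.SmoothPoincare4.Theorems.MargerinRails

end
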